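import Summits.Parity.GeneralizedHardyLittlewood.Theorems.ModelHyperbolicity.Negative.ModelHyperbolicityTopCellObstruction

/-!
# `ModelHyperbolicity` (stmt-Parity-14110): the MACLAURIN OBSTRUCTION (all higher Newton windows at once)

Part 6 of the cdisprove seat's negative lemmas (gen-3 seat, crux cycle 2). Part 4
(`…TopCellObstruction`) is the first Newton inequality for the reduced cell polynomial
`Q_{u,x} = Σ_{j<u} A_{j+1}(x) X^j`; this file proves the whole MACLAURIN family:

* `not_realRootedAt_of_maclaurin` — if `A_D > 0` is the top non-vanishing cell then `RealRootedAt u x`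
  forces `m! · A_{D−m} · A_D^{m−1} ≤ A_{D−1}^m` for every `2 ≤ m ≤ D − 1`; so one failing index `m`
  gives `¬ RealRootedAt u x`. Proof: the zeros of `Q_{u,x}` are real (hypothesis) AND `≤ 0` (its
  coefficients are `≥ 0`), by Vieta `A_{D−k} = A_D · e_k(a)` with `a ≥ 0` the negated zeros, and
  `m! · e_m(a) ≤ e_1(a)^m` (`factorial_mul_esymm_le_sum_pow`, by `e_{m+1}(a ∷ s) = e_{m+1}(s) + a·e_m(s)`
  and the two-term Bernoulli inequality `pow_succ_add_mul_le`).
* Tools of independent use: `card_roots_eq_natDegree_of_im_eq_zero` (a real polynomial all of whose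
  complex zeros are real splits over `ℝ` — root multiplicities are preserved under `ℝ → ℂ`),
  `esymm_map_neg`, `esymm_nonneg`.

Used by part 7 (`…ThresholdGrowth`: `x₀(u) ≥ B^u` eventually, for every `B`). [folklore]
-/

namespace Summit.Parity.GeneralizedHardyLittlewood.Theorems.ModelHyperbolicity.Negative

open Summit.Parity.GeneralizedHardyLittlewood.Theses.LeeYangFibres
open Finset Polynomial
open scoped Classical Nat

/-! ## §H1 Maclaurin's inequality `m!·e_m(a) ≤ (Σ a)^m` for non-negative reals -/

/-- Elementary symmetric functions of non-negative reals are non-negative. -/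
theorem esymm_nonneg {s : Multiset ℝ} (hs : ∀ x ∈ s, 0 ≤ x) (i : ℕ) : 0 ≤ s.esymm i := by
  simp only [Multiset.esymm]
  refine Multiset.sum_nonneg fun y hy => ?_
  obtain ⟨t, ht, rfl⟩ := Multiset.mem_map.mp hy
  exact Multiset.prod_nonneg fun b hb =>
    hs b (Multiset.mem_of_le (Multiset.mem_powersetCard.mp ht).1 hb)

/-- Bernoulli with two terms: `S^{n+1} + (n+1)·a·S^n ≤ (S + a)^{n+1}` for `S, a ≥ 0`. -/
theorem pow_succ_add_mul_le {S a : ℝ} (hS : 0 ≤ S) (ha : 0 ≤ a) (n : ℕ) :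
    S ^ (n + 1) + (n + 1 : ℝ) * a * S ^ n ≤ (S + a) ^ (n + 1) := by
  induction n with
  | zero => simp
  | succ n ih =>
    set T := S ^ n with hT
    set P := (S + a) ^ (n + 1) with hP
    have hT0 : 0 ≤ T := pow_nonneg hS n
    have H := mul_le_mul_of_nonneg_left ih (add_nonneg hS ha)
    have hn : (0 : ℝ) ≤ n := Nat.cast_nonneg n
    have e1 : (S + a) ^ (n + 1 + 1) = (S + a) * P := by rw [hP]; ring
    have e2 : S ^ (n + 1 + 1) = S * S * T := by rw [hT]; ring
    have e3 : S ^ (n + 1) = S * T := by rw [hT]; ring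
    rw [e1, e2, e3]
    rw [e3] at H
    push_cast
    nlinarith [H, mul_nonneg (mul_nonneg (mul_nonneg ha ha) hT0) hn, mul_nonneg (mul_nonneg ha ha) hT0]

/-- MACLAURIN: for a multiset `a` of non-negative reals, `m! · e_m(a) ≤ (Σ a)^m`. -/
theorem factorial_mul_esymm_le_sum_pow (s : Multiset ℝ) (hs : ∀ x ∈ s, 0 ≤ x) (m : ℕ) :
    (m ! : ℝ) * s.esymm m ≤ s.sum ^ m := by
  -- `e_0 = 1` and `e_{i+1}(a ∷ t) = e_{i+1}(t) + a·e_i(t)` (cf. `Literature.NumberTheory.Automorphic.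
  -- multiset_esymm_zero_right / multiset_esymm_cons_succ`, not imported to keep the cone small)
  have e0 : ∀ t : Multiset ℝ, t.esymm 0 = 1 := fun t => by
    simp [Multiset.esymm, Multiset.powersetCard_zero_left]
  have econs : ∀ (a : ℝ) (t : Multiset ℝ) (i : ℕ),
      (a ::ₘ t).esymm (i + 1) = t.esymm (i + 1) + a * t.esymm i := by
    intro a t i
    simp only [Multiset.esymm, Multiset.powersetCard_cons, Multiset.map_add, Multiset.sum_add,
      Multiset.map_map, Function.comp_def, Multiset.prod_cons]
    rw [← Multiset.sum_map_mul_left]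
  induction s using Multiset.induction_on generalizing m with
  | empty =>
    cases m with
    | zero => simp [e0]
    | succ m => simp [Multiset.esymm]
  | cons a s ih =>
    have ha : 0 ≤ a := hs a (Multiset.mem_cons_self a s)
    have hs' : ∀ x ∈ s, 0 ≤ x := fun x hx => hs x (Multiset.mem_cons_of_mem hx)
    have hS : 0 ≤ s.sum := Multiset.sum_nonneg hs'
    cases m with
    | zero => simp [e0]
    | succ m =>
      rw [econs, Multiset.sum_cons, Nat.factorial_succ]
      have ih1 := ih hs' (m + 1)
      have ih0 := ih hs' m
      have hem : 0 ≤ s.esymm m := esymm_nonneg hs' m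
      push_cast
      calc ((m : ℝ) + 1) * m ! * (s.esymm (m + 1) + a * s.esymm m)
          = ((m : ℝ) + 1) * ((((m + 1)! : ℕ) : ℝ) * s.esymm (m + 1)) / ((m : ℝ) + 1)
              + ((m : ℝ) + 1) * a * ((m ! : ℝ) * s.esymm m) := by
            rw [Nat.factorial_succ]; push_cast; field_simp
        _ ≤ ((m : ℝ) + 1) * s.sum ^ (m + 1) / ((m : ℝ) + 1) + ((m : ℝ) + 1) * a * s.sum ^ m := by
            gcongr
        _ = s.sum ^ (m + 1) + ((m : ℝ) + 1) * a * s.sum ^ m := by field_simp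
        _ ≤ (s.sum + a) ^ (m + 1) := pow_succ_add_mul_le hS ha m
        _ = (a + s.sum) ^ (m + 1) := by ring

/-! ## §H2 Real polynomials with only real complex zeros split over `ℝ`; the Maclaurin obstruction -/

/-- A nonzero real polynomial all of whose complex zeros are real has `natDegree` real roots. -/
theorem card_roots_eq_natDegree_of_im_eq_zero {p : ℝ[X]} (hp : p ≠ 0)
    (h : ∀ z : ℂ, (p.map (algebraMap ℝ ℂ)).eval z = 0 → z.im = 0) : p.roots.card = p.natDegree := by
  set q := p.map (algebraMap ℝ ℂ) with hq
  have hinj : Function.Injective (algebraMap ℝ ℂ) := (algebraMap ℝ ℂ).injective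
  have hq0 : q ≠ 0 := (Polynomial.map_ne_zero_iff hinj).mpr hp
  have hqcard : q.roots.card = p.natDegree := by
    rw [IsAlgClosed.card_roots_eq_natDegree, natDegree_map_eq_of_injective hinj]
  -- q.roots ≤ p.roots.map ofReal
  have hle : q.roots ≤ p.roots.map (algebraMap ℝ ℂ) := by
    rw [Multiset.le_iff_count]
    intro b
    by_cases hb : b ∈ q.roots
    · have hb0 : b.im = 0 := h b ((mem_roots hq0).mp hb)
      have hbre : (algebraMap ℝ ℂ) b.re = b := Complex.ext rfl (by simp [hb0])
      rw [← hbre, Multiset.count_map_eq_count' _ _ hinj, count_roots, count_roots,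
        ← eq_rootMultiplicity_map hinj]
    · rw [Multiset.count_eq_zero_of_notMem hb]
      exact Nat.zero_le _
  have h1 : p.natDegree ≤ p.roots.card := by
    calc p.natDegree = q.roots.card := hqcard.symm
      _ ≤ (p.roots.map (algebraMap ℝ ℂ)).card := Multiset.card_le_card hle
      _ = p.roots.card := Multiset.card_map _ _
  exact le_antisymm (card_roots' p) h1

/-- `e_m(−s) = (−1)^m e_m(s)`. -/
theorem esymm_map_neg {R : Type*} [CommRing R] (s : Multiset R) (m : ℕ) :
    (s.map Neg.neg).esymm m = (-1) ^ m * s.esymm m := by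
  simp only [Multiset.esymm]
  rw [Multiset.powersetCard_map, Multiset.map_map, ← Multiset.sum_map_mul_left]
  refine congrArg _ (Multiset.map_congr rfl fun t ht => ?_)
  simp only [Function.comp_apply]
  rw [Multiset.prod_map_neg, (Multiset.mem_powersetCard.mp ht).2]

/-- MACLAURIN OBSTRUCTION. If `A_D > 0` is the top non-vanishing cell and, for some `2 ≤ m ≤ D − 1`,
`A_{D−1}^m < m! · A_{D−m} · A_D^{m−1}`, then `P_{u,x}` is not real-rooted. (Real zeros of the reduced
polynomial are `≤ 0` since its coefficients are `≥ 0`; by Vieta `A_{D−k} = A_D·e_k(a)` with `a ≥ 0` the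
negated zeros; and `m!·e_m(a) ≤ e_1(a)^m`.) For `m = 2` compare part 4's sharper first Newton inequality. -/
theorem not_realRootedAt_of_maclaurin {u x D m : ℕ} (hm : 2 ≤ m) (hmD : m + 1 ≤ D)
    (htop : ∀ j, D < j → cell u x j = 0) (hpos : 0 < cell u x D)
    (hlt : cell u x (D - 1) ^ m < m ! * cell u x (D - m) * cell u x D ^ (m - 1)) :
    ¬ RealRootedAt u x := by
  intro hreal
  have hu : 1 ≤ u := by
    rcases Nat.eq_zero_or_pos u with rfl | h
    · exact absurd hreal (not_realRootedAt_zero x)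
    · exact h
  have hDu : D < u := by
    by_contra h
    have := cell_eq_zero_of_le (x := x) (j := D) hu (by omega)
    omega
  set Q := cellPolyQ u x with hQ
  have hcoeff : ∀ i, Q.coeff i = if i < u then ((cell u x (i + 1) : ℕ) : ℝ) else 0 := cellPolyQ_coeff u x
  have hdeg : Q.natDegree = D - 1 := by
    apply natDegree_eq_of_le_of_coeff_ne_zero
    · rw [natDegree_le_iff_coeff_eq_zero]
      intro N hN
      rw [hcoeff]
      split_ifs
      · rw [htop (N + 1) (by omega)]; simp
      · rfl
    · rw [hcoeff, if_pos (by omega), show D - 1 + 1 = D by omega]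
      exact_mod_cast hpos.ne'
  have hlead : Q.leadingCoeff = (cell u x D : ℝ) := by
    rw [leadingCoeff, hdeg, hcoeff, if_pos (by omega), show D - 1 + 1 = D by omega]
  have hQ0 : Q ≠ 0 := by
    intro h0; rw [h0, natDegree_zero] at hdeg; omega
  -- all complex zeros of Q are real: a zero z of Q gives the zero z of P_{u,x} = z·Q(z)
  have him : ∀ z : ℂ, (Q.map (algebraMap ℝ ℂ)).eval z = 0 → z.im = 0 := fun z hz =>
    hreal z (by rw [cellPoly_eq_mul_Q, ← hQ, hz, mul_zero])
  have hcard : Q.roots.card = Q.natDegree := card_roots_eq_natDegree_of_im_eq_zero hQ0 him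
  -- every (real) root is ≤ 0: at t > 0 the value is ≥ A_D t^{D-1} > 0
  have hroot_nonpos : ∀ r ∈ Q.roots, r ≤ 0 := by
    intro r hr
    have hr0 : Q.eval r = 0 := (mem_roots hQ0).mp hr
    by_contra hpos'
    push Not at hpos'
    have hterm : ∀ i ∈ Finset.range u, (0 : ℝ) ≤ ((cell u x (i + 1) : ℕ) : ℝ) * r ^ i :=
      fun i _ => by positivity
    have hle := Finset.single_le_sum hterm (a := D - 1) (Finset.mem_range.mpr (by omega))
    rw [← cellPolyQ_eval, ← hQ, hr0, show D - 1 + 1 = D by omega] at hle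
    have : (0 : ℝ) < ((cell u x D : ℕ) : ℝ) * r ^ (D - 1) := by
      have : (0 : ℝ) < (cell u x D : ℝ) := by exact_mod_cast hpos
      positivity
    linarith
  -- the negated roots
  set a : Multiset ℝ := Q.roots.map Neg.neg with ha
  have ha_nonneg : ∀ y ∈ a, 0 ≤ y := by
    intro y hy
    obtain ⟨r, hr, rfl⟩ := Multiset.mem_map.mp hy
    have := hroot_nonpos r hr
    linarith
  -- Vieta: A_{D-k} = A_D * e_k(a) for k ≤ D - 1
  have hvieta : ∀ k, k ≤ D - 1 → ((cell u x (D - k) : ℕ) : ℝ) = (cell u x D : ℝ) * a.esymm k := by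
    intro k hk
    have hv := coeff_eq_esymm_roots_of_card hcard (show D - 1 - k ≤ Q.natDegree by omega)
    rw [hdeg, hlead, hcoeff, if_pos (by omega), show D - 1 - (D - 1 - k) = k by omega,
      show D - 1 - k + 1 = D - k by omega] at hv
    rw [hv, ha, esymm_map_neg]
    ring
  have hv1 := hvieta 1 (by omega)
  have hvm := hvieta m (by omega)
  rw [esymm_one_eq_sum] at hv1
  -- Maclaurin
  have hmac := factorial_mul_esymm_le_sum_pow a ha_nonneg m
  have hAD : (0 : ℝ) < (cell u x D : ℝ) := by exact_mod_cast hpos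
  -- m! * A_{D-m} * A_D^(m-1) = A_D^m * (m! * e_m(a)) ≤ A_D^m * (a.sum)^m = A_{D-1}^m
  have key : (m ! : ℝ) * (cell u x (D - m) : ℝ) * (cell u x D : ℝ) ^ (m - 1) ≤ (cell u x (D - 1) : ℝ) ^ m := by
    obtain ⟨m', rfl⟩ : ∃ m', m = m' + 1 := ⟨m - 1, by omega⟩
    rw [Nat.add_sub_cancel, hvm, hv1, mul_pow]
    calc ((m' + 1)! : ℝ) * ((cell u x D : ℝ) * a.esymm (m' + 1)) * (cell u x D : ℝ) ^ m'
        = (cell u x D : ℝ) ^ (m' + 1) * (((m' + 1)! : ℝ) * a.esymm (m' + 1)) := by ring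
      _ ≤ (cell u x D : ℝ) ^ (m' + 1) * a.sum ^ (m' + 1) := by gcongr
  have hlt' : ((cell u x (D - 1) : ℕ) : ℝ) ^ m <
      (m ! : ℝ) * ((cell u x (D - m) : ℕ) : ℝ) * ((cell u x D : ℕ) : ℝ) ^ (m - 1) := by
    exact_mod_cast hlt
  linarith

end Summit.Parity.GeneralizedHardyLittlewood.Theorems.ModelHyperbolicity.Negative
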